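import Summits.CriticalPhenomena.SAWScalingLimit.Theses.SAWRenewalTightness
import Summits.CriticalPhenomena.SAWScalingLimit.Theorems.SAWRenewalTightnessStripMassConservation
import Literature.Probability.RandomPlanarGeometry.SAWBridges

/-!
# Hairpin hysteresis from its conditioned forms (line `kesten-defect-renewal`, stub S4)

Support file for crux `SAWRenewalTightness.ShellCrossingBound` (stmt-CriticalPhenomena-4728), stub
`stub_hairpin_of_tubeMass` (S4) of `Cruxes/ShellCrossingBound/Lines/kesten_defect_renewal.lean`: in
the pocket `P_W = {0 ≤ v₀, 0 ≤ v₁ < W}` with mouth points `p = (0,y₁) ≠ q = (0,y₂)`, the `x_c`-mass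
of SAWs `p → q` of depth `≥ C₀W` is `≤ η ×` that of depth `≥ W` (`∃ C₀ ≥ 2, η < 1`, partial sums).
The open content of S4 is CONDITIONAL (domain Markov / Kemppainen–Smirnov "unforced crossing given
the past"); this file proves the bookkeeping that turns conditional forms into S4 verbatim:
* `Hairpin.exists_partialSum_le_of_fiberwise` — abstract lemma: if every key-class of a filtered
  double partial sum is dominated by `η ×` a later partial sum of the matching class of a second
  filter, the unconditioned sums are dominated with constant `max η 0` (finitely many classes occur
  below level `N`; take the largest witness);
* `hairpin_of_boxConditionedHairpin` — SPATIAL conditioning on the set of steps in the mouth box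
  `{v₀ < W}`; caveat: its hypothesis quantifies over all traces, including traces with `W/2` densely
  nested feet on the line `v₀ = W - 1/2`, which force depth `≥ W/2` and drive the conditional ratio
  at `C₀ = 2` to `0.30` at `W = 10`, rising with `W` (S4 worker, exact transfer matrix, kit j016495);
* `hairpin_of_pastConditionedHairpin` — TEMPORAL conditioning on the past up to the first passage to
  depth `W` (one future strand in the clean half-strip): the robust atom, = KS Condition G1 for the
  straight pocket; numerically the one-excursion conditional ratio is `≈ 0.02` whatever the feet;
* `Hairpin.exists_partialSum_le_of_complement`, `hairpin_of_comparable` — no smallness is needed: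
  deep mass `≤ K ×` the mass of depth in `[W, C₀W)` for SOME `K` gives S4 with `η = K/(1+K)`.
Sources: KemppainenSmirnov2017 (arXiv:1212.6215) §1.1 (G1), Cor. 2.6; MadrasSlade1993 §1.2.
-/

open Finset
open Literature.Probability.LatticeModels
open Literature.Probability.RandomPlanarGeometry
open scoped BigOperators

namespace Summit.CriticalPhenomena.SAWScalingLimit.Theorems
namespace Hairpin

/-- **Fiberwise domination of partial sums.**  `s n` finite sets, `w n ≥ 0`, filters `P n`,
`Q n`, any labelling `key n : ι → κ`, class filters with `P n i ∧ key n i = I → Pc n I i` and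
`Qc n I i → Q n i ∧ key n i = I`.  If for every label `I` and every `N` some `N'` has
`∑_{n ≤ N} ∑_{s n, Pc n I} w n ≤ η ∑_{n ≤ N'} ∑_{s n, Qc n I} w n`, then for every `N` some `N'` has
`∑_{n ≤ N} ∑_{s n, P n} w n ≤ max η 0 · ∑_{n ≤ N'} ∑_{s n, Q n} w n` (the labels of the finitely many
numerator terms form a finite set `𝓘`; take the largest witness over `𝓘`, decompose the numerator
fiberwise, recombine the disjoint denominator classes). [folklore] -/
theorem exists_partialSum_le_of_fiberwise {ι κ : Type*} [DecidableEq κ]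
    (s : ℕ → Finset ι) (P Q : ℕ → ι → Prop) (Pc Qc : ℕ → κ → ι → Prop)
    [∀ n, DecidablePred (P n)] [∀ n, DecidablePred (Q n)]
    [∀ n I, DecidablePred (Pc n I)] [∀ n I, DecidablePred (Qc n I)]
    (key : ℕ → ι → κ) (w : ℕ → ℝ) (hw : ∀ n, 0 ≤ w n) (η : ℝ)
    (hP : ∀ n I i, i ∈ s n → P n i → key n i = I → Pc n I i)
    (hQ : ∀ n I i, i ∈ s n → Qc n I i → Q n i ∧ key n i = I)
    (h : ∀ I : κ, ∀ N : ℕ, ∃ N' : ℕ,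
      (∑ n ∈ range (N + 1), ∑ _i ∈ (s n).filter (Pc n I), w n) ≤
        η * ∑ n ∈ range (N' + 1), ∑ _i ∈ (s n).filter (Qc n I), w n)
    (N : ℕ) : ∃ N' : ℕ,
      (∑ n ∈ range (N + 1), ∑ _i ∈ (s n).filter (P n), w n) ≤
        max η 0 * ∑ n ∈ range (N' + 1), ∑ _i ∈ (s n).filter (Q n), w n := by
  classical
  -- the labels occurring in the numerator below level `N`
  set 𝓘 : Finset κ := (range (N + 1)).biUnion (fun n => ((s n).filter (P n)).image (key n))
    with h𝓘
  choose Nf hNf using fun I => h I N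
  refine ⟨𝓘.sup Nf, ?_⟩
  set η' : ℝ := max η 0 with hη'def
  have hη' : 0 ≤ η' := le_max_right _ _
  have hηle : η ≤ η' := le_max_left _ _
  have hnn : ∀ (n : ℕ) (t : Finset ι), 0 ≤ ∑ _i ∈ t, w n :=
    fun n t => sum_nonneg fun _ _ => hw n
  -- Step 1: the numerator is the sum of its label classes
  have step1 : (∑ n ∈ range (N + 1), ∑ _i ∈ (s n).filter (P n), w n)
      = ∑ I ∈ 𝓘, ∑ n ∈ range (N + 1),
          ∑ _i ∈ (s n).filter (fun i => P n i ∧ key n i = I), w n := by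
    rw [sum_comm]
    refine sum_congr rfl fun n hn => ?_
    have hmaps : ∀ i ∈ (s n).filter (P n), key n i ∈ 𝓘 := by
      intro i hi
      rw [h𝓘, mem_biUnion]
      exact ⟨n, hn, mem_image_of_mem _ hi⟩
    rw [← sum_fiberwise_of_maps_to hmaps]
    refine sum_congr rfl fun I _ => ?_
    rw [filter_filter]
  -- Step 2: each class is dominated, with the common witness `𝓘.sup Nf`
  have step2 : ∀ I ∈ 𝓘,
      (∑ n ∈ range (N + 1), ∑ _i ∈ (s n).filter (fun i => P n i ∧ key n i = I), w n)
        ≤ η' * ∑ n ∈ range (𝓘.sup Nf + 1),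
            ∑ _i ∈ (s n).filter (fun i => Q n i ∧ key n i = I), w n := by
    intro I hI
    calc (∑ n ∈ range (N + 1), ∑ _i ∈ (s n).filter (fun i => P n i ∧ key n i = I), w n)
        ≤ ∑ n ∈ range (N + 1), ∑ _i ∈ (s n).filter (Pc n I), w n := by
          refine sum_le_sum fun n _ => sum_le_sum_of_subset_of_nonneg ?_ fun _ _ _ => hw n
          intro i hi
          rw [mem_filter] at hi ⊢
          exact ⟨hi.1, hP n I i hi.1 hi.2.1 hi.2.2⟩
      _ ≤ η * ∑ n ∈ range (Nf I + 1), ∑ _i ∈ (s n).filter (Qc n I), w n := hNf I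
      _ ≤ η' * ∑ n ∈ range (Nf I + 1), ∑ _i ∈ (s n).filter (Qc n I), w n :=
          mul_le_mul_of_nonneg_right hηle (sum_nonneg fun n _ => hnn n _)
      _ ≤ η' * ∑ n ∈ range (𝓘.sup Nf + 1), ∑ _i ∈ (s n).filter (Qc n I), w n := by
          refine mul_le_mul_of_nonneg_left ?_ hη'
          refine sum_le_sum_of_subset_of_nonneg ?_ fun n _ _ => hnn n _
          exact range_subset_range.2 (Nat.succ_le_succ (le_sup hI))
      _ ≤ η' * ∑ n ∈ range (𝓘.sup Nf + 1),
            ∑ _i ∈ (s n).filter (fun i => Q n i ∧ key n i = I), w n := by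
          refine mul_le_mul_of_nonneg_left ?_ hη'
          refine sum_le_sum fun n _ => sum_le_sum_of_subset_of_nonneg ?_ fun _ _ _ => hw n
          intro i hi
          rw [mem_filter] at hi ⊢
          exact ⟨hi.1, hQ n I i hi.1 hi.2⟩
  -- Step 3: the denominator classes are disjoint pieces of the denominator
  have step3 : (∑ I ∈ 𝓘, ∑ n ∈ range (𝓘.sup Nf + 1),
        ∑ _i ∈ (s n).filter (fun i => Q n i ∧ key n i = I), w n)
      ≤ ∑ n ∈ range (𝓘.sup Nf + 1), ∑ _i ∈ (s n).filter (Q n), w n := by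
    rw [sum_comm]
    refine sum_le_sum fun n _ => ?_
    have hfib : (∑ I ∈ 𝓘, ∑ _i ∈ (s n).filter (fun i => Q n i ∧ key n i = I), w n)
        = ∑ _i ∈ ((s n).filter (Q n)).filter (fun i => key n i ∈ 𝓘), w n := by
      rw [← sum_fiberwise_eq_sum_filter ((s n).filter (Q n)) 𝓘 (key n) (fun _ => w n)]
      refine sum_congr rfl fun I _ => ?_
      rw [filter_filter]
    rw [hfib]
    exact sum_le_sum_of_subset_of_nonneg (filter_subset _ _) fun _ _ _ => hw n
  -- assemble
  calc (∑ n ∈ range (N + 1), ∑ _i ∈ (s n).filter (P n), w n)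
      = ∑ I ∈ 𝓘, ∑ n ∈ range (N + 1),
          ∑ _i ∈ (s n).filter (fun i => P n i ∧ key n i = I), w n := step1
    _ ≤ ∑ I ∈ 𝓘, η' * ∑ n ∈ range (𝓘.sup Nf + 1),
          ∑ _i ∈ (s n).filter (fun i => Q n i ∧ key n i = I), w n := sum_le_sum step2
    _ = η' * ∑ I ∈ 𝓘, ∑ n ∈ range (𝓘.sup Nf + 1),
          ∑ _i ∈ (s n).filter (fun i => Q n i ∧ key n i = I), w n := by rw [mul_sum]
    _ ≤ η' * ∑ n ∈ range (𝓘.sup Nf + 1), ∑ _i ∈ (s n).filter (Q n), w n :=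
        mul_le_mul_of_nonneg_left step3 hη'

/-- **Comparability with the complement suffices (no smallness needed).**  If the `P`-partial
sums are dominated by `K ×` later partial sums over `Q ∧ ¬ P`, and `P → Q` on `s n`, then the
`P`-partial sums are dominated by `max K 0 / (1 + max K 0) < 1` times later `Q`-partial sums:
`(1 + K) S_P ≤ K (S_P + S_{Q ∧ ¬P}) ≤ K S_Q`. [folklore] -/
theorem exists_partialSum_le_of_complement {ι : Type*}
    (s : ℕ → Finset ι) (P Q : ℕ → ι → Prop) [∀ n, DecidablePred (P n)] [∀ n, DecidablePred (Q n)]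
    (w : ℕ → ℝ) (hw : ∀ n, 0 ≤ w n) (K : ℝ)
    (hPQ : ∀ n i, i ∈ s n → P n i → Q n i)
    (h : ∀ N : ℕ, ∃ N' : ℕ,
      (∑ n ∈ range (N + 1), ∑ _i ∈ (s n).filter (P n), w n) ≤
        K * ∑ n ∈ range (N' + 1), ∑ _i ∈ (s n).filter (fun i => Q n i ∧ ¬ P n i), w n)
    (N : ℕ) : ∃ N' : ℕ,
      (∑ n ∈ range (N + 1), ∑ _i ∈ (s n).filter (P n), w n) ≤
        max K 0 / (1 + max K 0) * ∑ n ∈ range (N' + 1), ∑ _i ∈ (s n).filter (Q n), w n := by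
  classical
  obtain ⟨N', hN'⟩ := h N
  refine ⟨max N N', ?_⟩
  set K' : ℝ := max K 0 with hK'def
  have hK' : 0 ≤ K' := le_max_right _ _
  have h1K : 0 < 1 + K' := by linarith
  have hnn : ∀ (n : ℕ) (t : Finset ι), 0 ≤ ∑ _i ∈ t, w n :=
    fun n t => sum_nonneg fun _ _ => hw n
  set SP : ℝ := ∑ n ∈ range (N + 1), ∑ _i ∈ (s n).filter (P n), w n with hSP
  set SQ : ℝ := ∑ n ∈ range (max N N' + 1), ∑ _i ∈ (s n).filter (Q n), w n with hSQ
  -- split the `Q`-sum at level `max N N'` into its `P` and `¬ P` parts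
  have hsplit : SQ = (∑ n ∈ range (max N N' + 1), ∑ _i ∈ ((s n).filter (Q n)).filter (P n), w n)
      + ∑ n ∈ range (max N N' + 1), ∑ _i ∈ ((s n).filter (Q n)).filter (fun i => ¬ P n i), w n := by
    rw [hSQ, ← sum_add_distrib]
    refine sum_congr rfl fun n _ => ?_
    rw [sum_filter_add_sum_filter_not]
  have hP_le : SP ≤ ∑ n ∈ range (max N N' + 1), ∑ _i ∈ ((s n).filter (Q n)).filter (P n), w n := by
    refine (sum_le_sum_of_subset_of_nonneg (range_subset_range.2 (Nat.succ_le_succ (le_max_left N N')))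
      fun n _ _ => hnn n _).trans (sum_le_sum fun n _ => ?_)
    refine sum_le_sum_of_subset_of_nonneg ?_ fun _ _ _ => hw n
    intro i hi
    rw [mem_filter] at hi
    rw [mem_filter, mem_filter]
    exact ⟨⟨hi.1, hPQ n i hi.1 hi.2⟩, hi.2⟩
  have hC_le : (∑ n ∈ range (N' + 1), ∑ _i ∈ (s n).filter (fun i => Q n i ∧ ¬ P n i), w n)
      ≤ ∑ n ∈ range (max N N' + 1), ∑ _i ∈ ((s n).filter (Q n)).filter (fun i => ¬ P n i), w n := by
    refine (sum_le_sum_of_subset_of_nonneg (range_subset_range.2 (Nat.succ_le_succ (le_max_right N N')))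
      fun n _ _ => hnn n _).trans (sum_le_sum fun n _ => ?_)
    rw [filter_filter]
  have hSP_le : SP ≤ K' * ∑ n ∈ range (N' + 1), ∑ _i ∈ (s n).filter (fun i => Q n i ∧ ¬ P n i), w n :=
    hN'.trans (mul_le_mul_of_nonneg_right (le_max_left _ _) (sum_nonneg fun n _ => hnn n _))
  have hkey : SP * (1 + K') ≤ K' * SQ := by
    rw [hsplit, mul_add, mul_add, mul_one]
    nlinarith [mul_le_mul_of_nonneg_left hP_le hK', mul_le_mul_of_nonneg_left hC_le hK']
  rw [div_mul_eq_mul_div, le_div_iff₀ h1K]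
  exact hkey

end Hairpin

/-- **Box-conditioned hairpin bound ⇒ S4's conclusion, same aspect ratio.**  Hypothesis: there
are `C₀ ≥ 2`, `η < 1` such that for every `W ≥ 1`, mouth points `p = (0,y₁) ≠ q = (0,y₂)` of
`P_W = {0 ≤ v₀, 0 ≤ v₁ < W}` and every finite set `I` of lattice steps, among the SAWs `p → q` in
`P_W` whose set of steps inside the mouth box `{v₀ < W}` is exactly `I`, the `x_c`-mass of those
reaching depth `C₀W` is `≤ η ×` the mass of those reaching depth `W` (`∀ N ∃ N'`).  By the spatial
Markov property the class `I` fixes the feet on the line `v₀ = W - 1/2` and leaves free only the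
system of excursions beyond it.  Caveat (S4 worker, exact transfer matrix, `W ≤ 11`): the supremum
of the conditional ratio over ALL traces sits at traces with `W/2` densely nested feet, `0.30` at
`W = 10` for `C₀ = 2` (rising with `W`), `1.2·10⁻³` for `C₀ = 3`; `hairpin_of_pastConditionedHairpin`
is the robust form.  Proof: `Hairpin.exists_partialSum_le_of_fiberwise`, `key` = steps in the box.
[cite: KemppainenSmirnov2017, §1.1 Condition G1, Cor. 2.6] -/
theorem hairpin_of_boxConditionedHairpin :
    (∃ (C₀ : ℕ) (η : ℝ), 2 ≤ C₀ ∧ η < 1 ∧ ∀ W : ℕ, 1 ≤ W → ∀ y₁ y₂ : ℕ, y₁ < W → y₂ < W → y₁ ≠ y₂ →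
      ∀ I : Finset (Site 2 × Site 2), ∀ N : ℕ, ∃ N' : ℕ,
        (∑ n ∈ Finset.range (N + 1),
          ∑ _ω ∈ (SAW.Zd.sawFun 2 n (![0, (y₂ : ℤ)] - ![0, (y₁ : ℤ)])).filter (fun ω =>
              (∀ i ≤ n, 0 ≤ (![0, (y₁ : ℤ)] + ω i) 0 ∧ 0 ≤ (![0, (y₁ : ℤ)] + ω i) 1 ∧
                (![0, (y₁ : ℤ)] + ω i) 1 < W) ∧
              (∃ i ≤ n, (C₀ : ℤ) * W ≤ (![0, (y₁ : ℤ)] + ω i) 0) ∧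
              ((Finset.range n).filter (fun i => (![0, (y₁ : ℤ)] + ω i) 0 < W ∧
                  (![0, (y₁ : ℤ)] + ω (i + 1)) 0 < W)).image
                (fun i => (![0, (y₁ : ℤ)] + ω i, ![0, (y₁ : ℤ)] + ω (i + 1))) = I),
            SAW.criticalFugacity ^ n)
        ≤ η * ∑ n ∈ Finset.range (N' + 1),
          ∑ _ω ∈ (SAW.Zd.sawFun 2 n (![0, (y₂ : ℤ)] - ![0, (y₁ : ℤ)])).filter (fun ω =>
              (∀ i ≤ n, 0 ≤ (![0, (y₁ : ℤ)] + ω i) 0 ∧ 0 ≤ (![0, (y₁ : ℤ)] + ω i) 1 ∧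
                (![0, (y₁ : ℤ)] + ω i) 1 < W) ∧
              (∃ i ≤ n, (W : ℤ) ≤ (![0, (y₁ : ℤ)] + ω i) 0) ∧
              ((Finset.range n).filter (fun i => (![0, (y₁ : ℤ)] + ω i) 0 < W ∧
                  (![0, (y₁ : ℤ)] + ω (i + 1)) 0 < W)).image
                (fun i => (![0, (y₁ : ℤ)] + ω i, ![0, (y₁ : ℤ)] + ω (i + 1))) = I),
            SAW.criticalFugacity ^ n) →
    ∃ (C₀ : ℕ) (η : ℝ), 2 ≤ C₀ ∧ η < 1 ∧ ∀ W : ℕ, 1 ≤ W → ∀ y₁ y₂ : ℕ, y₁ < W → y₂ < W → y₁ ≠ y₂ →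
      ∀ N : ℕ, ∃ N' : ℕ,
        (∑ n ∈ Finset.range (N + 1),
          ∑ _ω ∈ (SAW.Zd.sawFun 2 n (![0, (y₂ : ℤ)] - ![0, (y₁ : ℤ)])).filter (fun ω =>
              (∀ i ≤ n, 0 ≤ (![0, (y₁ : ℤ)] + ω i) 0 ∧ 0 ≤ (![0, (y₁ : ℤ)] + ω i) 1 ∧
                (![0, (y₁ : ℤ)] + ω i) 1 < W) ∧
              (∃ i ≤ n, (C₀ : ℤ) * W ≤ (![0, (y₁ : ℤ)] + ω i) 0)),
            SAW.criticalFugacity ^ n)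
        ≤ η * ∑ n ∈ Finset.range (N' + 1),
          ∑ _ω ∈ (SAW.Zd.sawFun 2 n (![0, (y₂ : ℤ)] - ![0, (y₁ : ℤ)])).filter (fun ω =>
              (∀ i ≤ n, 0 ≤ (![0, (y₁ : ℤ)] + ω i) 0 ∧ 0 ≤ (![0, (y₁ : ℤ)] + ω i) 1 ∧
                (![0, (y₁ : ℤ)] + ω i) 1 < W) ∧
              (∃ i ≤ n, (W : ℤ) ≤ (![0, (y₁ : ℤ)] + ω i) 0)),
            SAW.criticalFugacity ^ n := by
  rintro ⟨C₀, η, hC₀, hη, hF⟩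
  refine ⟨C₀, max η 0, hC₀, max_lt hη one_pos, ?_⟩
  intro W hW y₁ y₂ hy₁ hy₂ hne N
  have hw : ∀ n : ℕ, 0 ≤ SAW.criticalFugacity ^ n :=
    fun n => pow_nonneg StripMass.criticalFugacity_pos.le n
  exact Hairpin.exists_partialSum_le_of_fiberwise
    (fun n => SAW.Zd.sawFun 2 n (![0, (y₂ : ℤ)] - ![0, (y₁ : ℤ)]))
    (fun n ω => (∀ i ≤ n, 0 ≤ (![0, (y₁ : ℤ)] + ω i) 0 ∧ 0 ≤ (![0, (y₁ : ℤ)] + ω i) 1 ∧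
        (![0, (y₁ : ℤ)] + ω i) 1 < W) ∧
      (∃ i ≤ n, (C₀ : ℤ) * W ≤ (![0, (y₁ : ℤ)] + ω i) 0))
    (fun n ω => (∀ i ≤ n, 0 ≤ (![0, (y₁ : ℤ)] + ω i) 0 ∧ 0 ≤ (![0, (y₁ : ℤ)] + ω i) 1 ∧
        (![0, (y₁ : ℤ)] + ω i) 1 < W) ∧
      (∃ i ≤ n, (W : ℤ) ≤ (![0, (y₁ : ℤ)] + ω i) 0))
    (fun n I ω => (∀ i ≤ n, 0 ≤ (![0, (y₁ : ℤ)] + ω i) 0 ∧ 0 ≤ (![0, (y₁ : ℤ)] + ω i) 1 ∧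
        (![0, (y₁ : ℤ)] + ω i) 1 < W) ∧
      (∃ i ≤ n, (C₀ : ℤ) * W ≤ (![0, (y₁ : ℤ)] + ω i) 0) ∧
      ((Finset.range n).filter (fun i => (![0, (y₁ : ℤ)] + ω i) 0 < W ∧
          (![0, (y₁ : ℤ)] + ω (i + 1)) 0 < W)).image
        (fun i => (![0, (y₁ : ℤ)] + ω i, ![0, (y₁ : ℤ)] + ω (i + 1))) = I)
    (fun n I ω => (∀ i ≤ n, 0 ≤ (![0, (y₁ : ℤ)] + ω i) 0 ∧ 0 ≤ (![0, (y₁ : ℤ)] + ω i) 1 ∧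
        (![0, (y₁ : ℤ)] + ω i) 1 < W) ∧
      (∃ i ≤ n, (W : ℤ) ≤ (![0, (y₁ : ℤ)] + ω i) 0) ∧
      ((Finset.range n).filter (fun i => (![0, (y₁ : ℤ)] + ω i) 0 < W ∧
          (![0, (y₁ : ℤ)] + ω (i + 1)) 0 < W)).image
        (fun i => (![0, (y₁ : ℤ)] + ω i, ![0, (y₁ : ℤ)] + ω (i + 1))) = I)
    (fun n ω => ((Finset.range n).filter (fun i => (![0, (y₁ : ℤ)] + ω i) 0 < W ∧
          (![0, (y₁ : ℤ)] + ω (i + 1)) 0 < W)).image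
        (fun i => (![0, (y₁ : ℤ)] + ω i, ![0, (y₁ : ℤ)] + ω (i + 1))))
    (fun n => SAW.criticalFugacity ^ n) hw η
    (fun n I ω _ hPω hk => ⟨hPω.1, hPω.2, hk⟩)
    (fun n I ω _ hQω => ⟨⟨hQω.1, hQω.2.1⟩, hQω.2.2⟩)
    (hF W hW y₁ y₂ hy₁ hy₂ hne) N

/-- **Past-conditioned (Kemppainen–Smirnov-type) hairpin bound ⇒ S4's conclusion, same aspect
ratio.**  Hypothesis (the robust conditional atom): there are `C₀ ≥ 2`, `η < 1` such that for every
`W ≥ 1`, mouth points `p = (0,y₁) ≠ q = (0,y₂)` and every finite set `A` of lattice steps, among the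
SAWs `p → q` in `P_W` whose set of steps taken while the depth is `< W` (the past up to and including
the first passage to depth `W`) is exactly `A`, the `x_c`-mass of those reaching depth `C₀W` is
`≤ η ×` the mass of those reaching depth `W` (`∀ N ∃ N'`).  For a genuine first-passage past `A` the
denominator is the mass of ALL futures (tip `→ q` in `P_W ∖ A`, one strand, free beyond the mouth
box by exact domain Markov) and the numerator that of the futures reaching depth `C₀W`: Condition G1
of Kemppainen–Smirnov for the straight pocket (an unforced crossing of the slab `[W, C₀W]` has
conditional probability `≤ η` given the past).  Proof: the fiberwise lemma with `key` = the past.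
[cite: KemppainenSmirnov2017, §1.1 Condition G1, Cor. 2.6] -/
theorem hairpin_of_pastConditionedHairpin :
    (∃ (C₀ : ℕ) (η : ℝ), 2 ≤ C₀ ∧ η < 1 ∧ ∀ W : ℕ, 1 ≤ W → ∀ y₁ y₂ : ℕ, y₁ < W → y₂ < W → y₁ ≠ y₂ →
      ∀ A : Finset (Site 2 × Site 2), ∀ N : ℕ, ∃ N' : ℕ,
        (∑ n ∈ Finset.range (N + 1),
          ∑ _ω ∈ (SAW.Zd.sawFun 2 n (![0, (y₂ : ℤ)] - ![0, (y₁ : ℤ)])).filter (fun ω =>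
              (∀ i ≤ n, 0 ≤ (![0, (y₁ : ℤ)] + ω i) 0 ∧ 0 ≤ (![0, (y₁ : ℤ)] + ω i) 1 ∧
                (![0, (y₁ : ℤ)] + ω i) 1 < W) ∧
              (∃ i ≤ n, (C₀ : ℤ) * W ≤ (![0, (y₁ : ℤ)] + ω i) 0) ∧
              ((Finset.range n).filter (fun i => ∀ j ≤ i, (![0, (y₁ : ℤ)] + ω j) 0 < W)).image
                (fun i => (![0, (y₁ : ℤ)] + ω i, ![0, (y₁ : ℤ)] + ω (i + 1))) = A),
            SAW.criticalFugacity ^ n)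
        ≤ η * ∑ n ∈ Finset.range (N' + 1),
          ∑ _ω ∈ (SAW.Zd.sawFun 2 n (![0, (y₂ : ℤ)] - ![0, (y₁ : ℤ)])).filter (fun ω =>
              (∀ i ≤ n, 0 ≤ (![0, (y₁ : ℤ)] + ω i) 0 ∧ 0 ≤ (![0, (y₁ : ℤ)] + ω i) 1 ∧
                (![0, (y₁ : ℤ)] + ω i) 1 < W) ∧
              (∃ i ≤ n, (W : ℤ) ≤ (![0, (y₁ : ℤ)] + ω i) 0) ∧
              ((Finset.range n).filter (fun i => ∀ j ≤ i, (![0, (y₁ : ℤ)] + ω j) 0 < W)).image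
                (fun i => (![0, (y₁ : ℤ)] + ω i, ![0, (y₁ : ℤ)] + ω (i + 1))) = A),
            SAW.criticalFugacity ^ n) →
    ∃ (C₀ : ℕ) (η : ℝ), 2 ≤ C₀ ∧ η < 1 ∧ ∀ W : ℕ, 1 ≤ W → ∀ y₁ y₂ : ℕ, y₁ < W → y₂ < W → y₁ ≠ y₂ →
      ∀ N : ℕ, ∃ N' : ℕ,
        (∑ n ∈ Finset.range (N + 1),
          ∑ _ω ∈ (SAW.Zd.sawFun 2 n (![0, (y₂ : ℤ)] - ![0, (y₁ : ℤ)])).filter (fun ω =>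
              (∀ i ≤ n, 0 ≤ (![0, (y₁ : ℤ)] + ω i) 0 ∧ 0 ≤ (![0, (y₁ : ℤ)] + ω i) 1 ∧
                (![0, (y₁ : ℤ)] + ω i) 1 < W) ∧
              (∃ i ≤ n, (C₀ : ℤ) * W ≤ (![0, (y₁ : ℤ)] + ω i) 0)),
            SAW.criticalFugacity ^ n)
        ≤ η * ∑ n ∈ Finset.range (N' + 1),
          ∑ _ω ∈ (SAW.Zd.sawFun 2 n (![0, (y₂ : ℤ)] - ![0, (y₁ : ℤ)])).filter (fun ω =>
              (∀ i ≤ n, 0 ≤ (![0, (y₁ : ℤ)] + ω i) 0 ∧ 0 ≤ (![0, (y₁ : ℤ)] + ω i) 1 ∧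
                (![0, (y₁ : ℤ)] + ω i) 1 < W) ∧
              (∃ i ≤ n, (W : ℤ) ≤ (![0, (y₁ : ℤ)] + ω i) 0)),
            SAW.criticalFugacity ^ n := by
  rintro ⟨C₀, η, hC₀, hη, hF⟩
  refine ⟨C₀, max η 0, hC₀, max_lt hη one_pos, ?_⟩
  intro W hW y₁ y₂ hy₁ hy₂ hne N
  have hw : ∀ n : ℕ, 0 ≤ SAW.criticalFugacity ^ n :=
    fun n => pow_nonneg StripMass.criticalFugacity_pos.le n
  exact Hairpin.exists_partialSum_le_of_fiberwise
    (fun n => SAW.Zd.sawFun 2 n (![0, (y₂ : ℤ)] - ![0, (y₁ : ℤ)]))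
    (fun n ω => (∀ i ≤ n, 0 ≤ (![0, (y₁ : ℤ)] + ω i) 0 ∧ 0 ≤ (![0, (y₁ : ℤ)] + ω i) 1 ∧
        (![0, (y₁ : ℤ)] + ω i) 1 < W) ∧
      (∃ i ≤ n, (C₀ : ℤ) * W ≤ (![0, (y₁ : ℤ)] + ω i) 0))
    (fun n ω => (∀ i ≤ n, 0 ≤ (![0, (y₁ : ℤ)] + ω i) 0 ∧ 0 ≤ (![0, (y₁ : ℤ)] + ω i) 1 ∧
        (![0, (y₁ : ℤ)] + ω i) 1 < W) ∧
      (∃ i ≤ n, (W : ℤ) ≤ (![0, (y₁ : ℤ)] + ω i) 0))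
    (fun n I ω => (∀ i ≤ n, 0 ≤ (![0, (y₁ : ℤ)] + ω i) 0 ∧ 0 ≤ (![0, (y₁ : ℤ)] + ω i) 1 ∧
        (![0, (y₁ : ℤ)] + ω i) 1 < W) ∧
      (∃ i ≤ n, (C₀ : ℤ) * W ≤ (![0, (y₁ : ℤ)] + ω i) 0) ∧
      ((Finset.range n).filter (fun i => ∀ j ≤ i, (![0, (y₁ : ℤ)] + ω j) 0 < W)).image
        (fun i => (![0, (y₁ : ℤ)] + ω i, ![0, (y₁ : ℤ)] + ω (i + 1))) = I)
    (fun n I ω => (∀ i ≤ n, 0 ≤ (![0, (y₁ : ℤ)] + ω i) 0 ∧ 0 ≤ (![0, (y₁ : ℤ)] + ω i) 1 ∧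
        (![0, (y₁ : ℤ)] + ω i) 1 < W) ∧
      (∃ i ≤ n, (W : ℤ) ≤ (![0, (y₁ : ℤ)] + ω i) 0) ∧
      ((Finset.range n).filter (fun i => ∀ j ≤ i, (![0, (y₁ : ℤ)] + ω j) 0 < W)).image
        (fun i => (![0, (y₁ : ℤ)] + ω i, ![0, (y₁ : ℤ)] + ω (i + 1))) = I)
    (fun n ω => ((Finset.range n).filter (fun i => ∀ j ≤ i, (![0, (y₁ : ℤ)] + ω j) 0 < W)).image
        (fun i => (![0, (y₁ : ℤ)] + ω i, ![0, (y₁ : ℤ)] + ω (i + 1))))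
    (fun n => SAW.criticalFugacity ^ n) hw η
    (fun n I ω _ hPω hk => ⟨hPω.1, hPω.2, hk⟩)
    (fun n I ω _ hQω => ⟨⟨hQω.1, hQω.2.1⟩, hQω.2.2⟩)
    (hF W hW y₁ y₂ hy₁ hy₂ hne) N

/-- **Comparability with the intermediate depths suffices for S4 (no smallness needed).**  If for
some `C₀ ≥ 2` and some constant `K` (however large) the `x_c`-mass of pocket walks `p → q` of depth
`≥ C₀W` is `≤ K ×` the mass of those of depth in `[W, C₀W)`, uniformly in `W` and the mouth points,
then the conclusion of `stub_hairpin_of_tubeMass` holds with the same `C₀` and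
`η = max K 0 / (1 + max K 0)`: S4 is a comparability statement, its content is uniformity in `W`.
[folklore] -/
theorem hairpin_of_comparable :
    (∃ (C₀ : ℕ) (K : ℝ), 2 ≤ C₀ ∧ ∀ W : ℕ, 1 ≤ W → ∀ y₁ y₂ : ℕ, y₁ < W → y₂ < W → y₁ ≠ y₂ →
      ∀ N : ℕ, ∃ N' : ℕ,
        (∑ n ∈ Finset.range (N + 1),
          ∑ _ω ∈ (SAW.Zd.sawFun 2 n (![0, (y₂ : ℤ)] - ![0, (y₁ : ℤ)])).filter (fun ω =>
              (∀ i ≤ n, 0 ≤ (![0, (y₁ : ℤ)] + ω i) 0 ∧ 0 ≤ (![0, (y₁ : ℤ)] + ω i) 1 ∧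
                (![0, (y₁ : ℤ)] + ω i) 1 < W) ∧
              (∃ i ≤ n, (C₀ : ℤ) * W ≤ (![0, (y₁ : ℤ)] + ω i) 0)),
            SAW.criticalFugacity ^ n)
        ≤ K * ∑ n ∈ Finset.range (N' + 1),
          ∑ _ω ∈ (SAW.Zd.sawFun 2 n (![0, (y₂ : ℤ)] - ![0, (y₁ : ℤ)])).filter (fun ω =>
              ((∀ i ≤ n, 0 ≤ (![0, (y₁ : ℤ)] + ω i) 0 ∧ 0 ≤ (![0, (y₁ : ℤ)] + ω i) 1 ∧
                (![0, (y₁ : ℤ)] + ω i) 1 < W) ∧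
              (∃ i ≤ n, (W : ℤ) ≤ (![0, (y₁ : ℤ)] + ω i) 0)) ∧
              ¬ ((∀ i ≤ n, 0 ≤ (![0, (y₁ : ℤ)] + ω i) 0 ∧ 0 ≤ (![0, (y₁ : ℤ)] + ω i) 1 ∧
                (![0, (y₁ : ℤ)] + ω i) 1 < W) ∧
              (∃ i ≤ n, (C₀ : ℤ) * W ≤ (![0, (y₁ : ℤ)] + ω i) 0))),
            SAW.criticalFugacity ^ n) →
    ∃ (C₀ : ℕ) (η : ℝ), 2 ≤ C₀ ∧ η < 1 ∧ ∀ W : ℕ, 1 ≤ W → ∀ y₁ y₂ : ℕ, y₁ < W → y₂ < W → y₁ ≠ y₂ →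
      ∀ N : ℕ, ∃ N' : ℕ,
        (∑ n ∈ Finset.range (N + 1),
          ∑ _ω ∈ (SAW.Zd.sawFun 2 n (![0, (y₂ : ℤ)] - ![0, (y₁ : ℤ)])).filter (fun ω =>
              (∀ i ≤ n, 0 ≤ (![0, (y₁ : ℤ)] + ω i) 0 ∧ 0 ≤ (![0, (y₁ : ℤ)] + ω i) 1 ∧
                (![0, (y₁ : ℤ)] + ω i) 1 < W) ∧
              (∃ i ≤ n, (C₀ : ℤ) * W ≤ (![0, (y₁ : ℤ)] + ω i) 0)),
            SAW.criticalFugacity ^ n)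
        ≤ η * ∑ n ∈ Finset.range (N' + 1),
          ∑ _ω ∈ (SAW.Zd.sawFun 2 n (![0, (y₂ : ℤ)] - ![0, (y₁ : ℤ)])).filter (fun ω =>
              (∀ i ≤ n, 0 ≤ (![0, (y₁ : ℤ)] + ω i) 0 ∧ 0 ≤ (![0, (y₁ : ℤ)] + ω i) 1 ∧
                (![0, (y₁ : ℤ)] + ω i) 1 < W) ∧
              (∃ i ≤ n, (W : ℤ) ≤ (![0, (y₁ : ℤ)] + ω i) 0)),
            SAW.criticalFugacity ^ n := by
  rintro ⟨C₀, K, hC₀, hK⟩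
  have hK0 : 0 ≤ max K 0 := le_max_right _ _
  refine ⟨C₀, max K 0 / (1 + max K 0), hC₀, (div_lt_one (by linarith)).2 (by linarith), ?_⟩
  intro W hW y₁ y₂ hy₁ hy₂ hne N
  have hw : ∀ n : ℕ, 0 ≤ SAW.criticalFugacity ^ n :=
    fun n => pow_nonneg StripMass.criticalFugacity_pos.le n
  have hC₀W : (W : ℤ) ≤ (C₀ : ℤ) * W := by
    have h2 : (2 : ℤ) ≤ C₀ := by exact_mod_cast hC₀
    nlinarith [Int.natCast_nonneg W]
  exact Hairpin.exists_partialSum_le_of_complement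
    (fun n => SAW.Zd.sawFun 2 n (![0, (y₂ : ℤ)] - ![0, (y₁ : ℤ)]))
    (fun n ω => (∀ i ≤ n, 0 ≤ (![0, (y₁ : ℤ)] + ω i) 0 ∧ 0 ≤ (![0, (y₁ : ℤ)] + ω i) 1 ∧
        (![0, (y₁ : ℤ)] + ω i) 1 < W) ∧
      (∃ i ≤ n, (C₀ : ℤ) * W ≤ (![0, (y₁ : ℤ)] + ω i) 0))
    (fun n ω => (∀ i ≤ n, 0 ≤ (![0, (y₁ : ℤ)] + ω i) 0 ∧ 0 ≤ (![0, (y₁ : ℤ)] + ω i) 1 ∧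
        (![0, (y₁ : ℤ)] + ω i) 1 < W) ∧
      (∃ i ≤ n, (W : ℤ) ≤ (![0, (y₁ : ℤ)] + ω i) 0))
    (fun n => SAW.criticalFugacity ^ n) hw K
    (fun n ω _ hP => ⟨hP.1, by
      obtain ⟨i, hi, hdeep⟩ := hP.2
      exact ⟨i, hi, hC₀W.trans hdeep⟩⟩)
    (hK W hW y₁ y₂ hy₁ hy₂ hne) N

end Summit.CriticalPhenomena.SAWScalingLimit.Theorems
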